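import Mathlib.MeasureTheory.Measure.Prod
import Mathlib.MeasureTheory.Function.StronglyMeasurable.Basic
import Literature.MathematicalPhysics.KineticTheory.InfiniteChainOrbitEnergyFlux
import HarnessLib

/-!
# Superstable invariant states are carried by all-time-good orbits (sup-in-time BM (2.6))

Topic `Literature/MathematicalPhysics/KineticTheory` (companion of `InfiniteChainSuperstableDynamics`).
Setting of P. Buttà, C. Marchioro, *Dynamics of infinite classical anharmonic crystals*, J. Stat.
Phys. 164 (2016) 680–692 (arXiv:1602.01294), §2, `d = ν = 1`: the chain `P : OscillatorChain` with
even non-negative polynomial `U`, `V`, BM's local energies `W_{μ,k}` (2.4), growth functional `Q`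
(2.5), good set `𝒳₀ = {Q < ∞}` (`bmGood`) and superstability estimate (2.3)
(`HasSuperstabilityEstimate`). BM's (2.6) (proved in the tree as
`ButtaMarchioro2016_eq26_chain_holds`) says `ω(𝒳₀) = 1` for every state `ω` obeying (2.3).

Main result (`OscillatorChain.ae_forall_flow_mem_bmGood`): if moreover `ω` is preserved by an
infinite-volume dynamics `D : InfiniteChainDynamics P` (ANY carrier, any flow solving the
equations: `D.PreservesMeasure ω`), then `ω`-almost every orbit stays in `𝒳₀` AT ALL TIMES,
`∀ᵐ σ ∂ω, ∀ t, D.flow t σ ∈ 𝒳₀`. (The fixed-time statement is immediate from (2.6) and measure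
preservation; the point is the uncountable intersection over `t`.) This is the SUP-IN-TIME variant
of (2.6): by the pathwise a priori bound `exp_bmLocalEnergy_comp_le`
(`InfiniteChainOrbitEnergyFlux`), for `σ` in a measurable full-measure part `S` of the carrier and
`t ∈ [0, τ]`,
`exp(λ W_{μ,k}(φ_t σ)) ≤ Y_{μ,k}(σ) := exp(λ W_{μ,k}(σ)) + (K/λ³) ∫₀^τ exp(2λ W_{μ,k+1}(φ_s σ)) ds`;
`Y_{μ,k}` is measurable (joint measurability of `(s, σ) ↦ W(φ_s σ)` from continuity of orbits and
measurability of each `φ_s`, `measurable_uncurry_of_continuous_of_measurable`) and, by Tonelli and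
the invariance of `ω` under each `φ_s`, `ω(Y_{μ,k}) ≤ e^{C'(2k+1)}` as soon as `2λ ≤ λ₀`
(`C' = C + (K/λ³) τ e^{2C}`). The exponential Chebyshev inequality and the union bound over the
boxes `Λ_{μ,k}`, `k > log(e+|μ|)` (`measure_boxUnion_le`, the argument of Buttà–Caglioti–Di Ruzza–
Marchioro 2007, Appendix, exactly as in `measure_bmGrowthSet_gt_le`) then give
`ω(∃ t ∈ [0,τ], Q(φ_t σ) > N) ≤ K e^{-(λN - C')} → 0`, i.e. a.e. orbit is in `𝒳₀` on `[0, τ]`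
(`ae_forall_mem_Icc_flow_mem_bmGood`); all `τ ∈ ℕ` by countable intersection, negative times by
the group law `flow_add` and invariance. Corollary for the tree's pinned quartic chain:
`ae_forall_flow_mem_bmGood_pinnedChain`.

Not printed in this form by BM (who assume invariant states and work on `𝒳₀` from the start);
standard, hence every declaration is tagged `[folklore]` (the union bound carries BM's citation).
No definitions, no named facts. Grounds the regularisation of Green–Kubo witnesses in
`Summit.AtomisticToContinuum.FouriersLaw` (a preserved superstable state can be given a dynamics
with carrier `⊆ 𝒳₀` and the same flow a.e.).
-/

noncomputable section

open MeasureTheory Filter Set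
open scoped Topology BigOperators ENNReal

namespace Literature.MathematicalPhysics.KineticTheory.HeatConduction

namespace OscillatorChain

/-! ### §1 The union bound over the boxes `Λ_{μ,k}`, `k > log(e + |μ|)` -/

/-- **Union bound over the admissible boxes** (abstract form of `measure_bmGrowthSet_gt_le`, the
argument of Buttà–Caglioti–Di Ruzza–Marchioro 2007, Appendix): there is a finite constant `K` such
that for every measure `ω`, every `a ≥ 3/2` and every family of events `A_{μ,k}`, empty unless
`k > log(e+|μ|)` and of measure `≤ e^{-a(2k+1)}` otherwise, `ω(⋃_{μ,k} A_{μ,k}) ≤ e^{-a} K`.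
[cite: ButtaMarchioro2016, §2 eq. (2.6)] -/
theorem measure_boxUnion_le {α : Type*} [MeasurableSpace α] :
    ∃ K : ℝ≥0∞, K ≠ ∞ ∧ ∀ (ω : Measure α) (a : ℝ), 3 / 2 ≤ a → ∀ A : ℤ → ℕ → Set α,
      (∀ (μ : ℤ) (k : ℕ), Real.log (Real.exp 1 + |(μ : ℝ)|) < k →
        ω (A μ k) ≤ ENNReal.ofReal (Real.exp (-a * (2 * (k : ℝ) + 1)))) →
      (∀ (μ : ℤ) (k : ℕ), ¬ Real.log (Real.exp 1 + |(μ : ℝ)|) < k → A μ k = ∅) →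
      ω (⋃ μ : ℤ, ⋃ k : ℕ, A μ k) ≤ ENNReal.ofReal (Real.exp (-a)) * K := by
  -- adapted from `measure_bmGrowthSet_gt_le` (InfiniteChainSuperstableDynamics)
  set ρ : ℝ≥0∞ := ENNReal.ofReal (Real.exp (-1)) with hρ
  set c : ℤ → ℝ≥0∞ := fun μ => ENNReal.ofReal (1 / |(μ : ℝ) + 1 / 2| ^ 2) with hc
  refine ⟨(∑' k : ℕ, ρ ^ k) * ∑' μ : ℤ, c μ, ENNReal.mul_ne_top ?_ ?_, fun ω a ha A hA hA' => ?_⟩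
  · rw [ENNReal.tsum_geometric, hρ]
    refine ENNReal.inv_ne_top.2 (tsub_pos_iff_lt.2 ?_).ne'
    exact ENNReal.ofReal_lt_one.2 (Real.exp_lt_one_iff.2 (by norm_num))
  · have hs : Summable fun μ : ℤ => 1 / |(μ : ℝ) + 1 / 2| ^ 2 := by
      have := (Real.summable_one_div_int_add_rpow (1 / 2) 2).2 one_lt_two
      simpa only [Real.rpow_two] using this
    rw [hc, ← ENNReal.ofReal_tsum_of_nonneg (fun μ => by positivity) hs]
    exact ENNReal.ofReal_ne_top
  · have hterm : ∀ (μ : ℤ) (k : ℕ),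
        ω (A μ k) ≤ ENNReal.ofReal (Real.exp (-a)) * (ρ ^ k * c μ) := by
      intro μ k
      by_cases hk : Real.log (Real.exp 1 + |(μ : ℝ)|) < k
      · calc ω (A μ k) ≤ ENNReal.ofReal (Real.exp (-a * (2 * (k : ℝ) + 1))) := hA μ k hk
          _ ≤ ENNReal.ofReal (Real.exp (-a) *
                (Real.exp (-1) ^ k * (1 / |(μ : ℝ) + 1 / 2| ^ 2))) :=
              ENNReal.ofReal_le_ofReal (exp_neg_mul_le_of_log_lt ha hk)
          _ = ENNReal.ofReal (Real.exp (-a)) * (ρ ^ k * c μ) := by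
              rw [ENNReal.ofReal_mul (Real.exp_nonneg _),
                ENNReal.ofReal_mul (pow_nonneg (Real.exp_nonneg _) _),
                ENNReal.ofReal_pow (Real.exp_nonneg _)]
      · rw [hA' μ k hk, measure_empty]
        exact zero_le
    calc ω (⋃ μ : ℤ, ⋃ k : ℕ, A μ k)
        ≤ ∑' μ : ℤ, ω (⋃ k : ℕ, A μ k) := measure_iUnion_le _
      _ ≤ ∑' μ : ℤ, ∑' k : ℕ, ω (A μ k) :=
          ENNReal.tsum_le_tsum fun μ => measure_iUnion_le _
      _ ≤ ∑' μ : ℤ, ∑' k : ℕ, ENNReal.ofReal (Real.exp (-a)) * (ρ ^ k * c μ) :=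
          ENNReal.tsum_le_tsum fun μ => ENNReal.tsum_le_tsum fun k => hterm μ k
      _ = ∑' μ : ℤ, ENNReal.ofReal (Real.exp (-a)) * ((∑' k : ℕ, ρ ^ k) * c μ) := by
          refine tsum_congr fun μ => ?_
          rw [ENNReal.tsum_mul_left, ENNReal.tsum_mul_right]
      _ = ENNReal.ofReal (Real.exp (-a)) * ((∑' k : ℕ, ρ ^ k) * ∑' μ : ℤ, c μ) := by
          rw [ENNReal.tsum_mul_left, ENNReal.tsum_mul_left]

/-! ### §2 A.e. orbit is good on a compact time interval -/

/-- **Sup-in-time BM (2.6) on `[0, τ]`.** For `U`, `V` even non-negative polynomials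
(`deg V = 2s₂ ≥ 2`), a state `ω` with the superstability estimate (2.3) and ANY infinite-volume dynamics
`D` preserving `ω`: for every `τ ≥ 0`, `ω`-a.e. `σ` has `D.flow t σ ∈ 𝒳₀` for all `t ∈ [0, τ]`.
[folklore] -/
theorem ae_forall_mem_Icc_flow_mem_bmGood (P : OscillatorChain) {s₁ s₂ : ℕ} (h₂ : 1 ≤ s₂)
    (hU : IsEvenPolyOfDegree P.U s₁) (hV : IsEvenPolyOfDegree P.V s₂) {ω : Measure ChainConfig}
    (hω : P.HasSuperstabilityEstimate ω) (D : InfiniteChainDynamics P) (hD : D.PreservesMeasure ω)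
    {τ : ℝ} (hτ : 0 ≤ τ) :
    ∀ᵐ σ ∂ω, ∀ t ∈ Icc (0 : ℝ) τ, D.flow t σ ∈ P.bmGood := by
  classical
  obtain ⟨hprob, C, lam₀, hC, hlam₀, hss⟩ := hω
  obtain ⟨K, hK, hpath⟩ := exp_bmLocalEnergy_comp_le h₂ hU hV
  obtain ⟨Kc, hKc, hunion⟩ := measure_boxUnion_le (α := ChainConfig)
  have hUd : Differentiable ℝ P.U := hU.contDiff_two.differentiable (by simp)
  have hVd : Differentiable ℝ P.V := hV.contDiff_two.differentiable (by simp)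
  have hWm : ∀ (m : ℤ) (k : ℕ), Measurable (P.bmLocalEnergy m k) := fun m k =>
    P.measurable_bmLocalEnergy hU.continuous.measurable hV.continuous.measurable m k
  -- constants: `λ = λ₀/2`, `c = K/λ³`, `M = c τ e^{2C}`, `C' = C + M`
  obtain ⟨lam, hlam_def⟩ : ∃ lam : ℝ, lam = lam₀ / 2 := ⟨_, rfl⟩
  have hlam : 0 < lam := by rw [hlam_def]; positivity
  have hlam1 : lam ≤ lam₀ := by rw [hlam_def]; linarith
  have hlam2 : 2 * lam ≤ lam₀ := by rw [hlam_def]; linarith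
  have h2lam : 0 < 2 * lam := by positivity
  obtain ⟨c, hc_def⟩ : ∃ c : ℝ, c = K / lam ^ 3 := ⟨_, rfl⟩
  have hc0 : 0 ≤ c := by rw [hc_def]; positivity
  obtain ⟨M, hM_def⟩ : ∃ M : ℝ, M = c * τ * Real.exp (2 * C) := ⟨_, rfl⟩
  have hM0 : 0 ≤ M := by rw [hM_def]; positivity
  obtain ⟨C', hC'_def⟩ : ∃ C' : ℝ, C' = C + M := ⟨_, rfl⟩
  -- a measurable full-measure subset `S` of the carrier
  obtain ⟨N₀, hsubN, hN₀m, hN₀⟩ := exists_measurable_superset_of_null (ae_iff.1 hD.1)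
  obtain ⟨S, hS_def⟩ : ∃ S : Set ChainConfig, S = N₀ᶜ := ⟨_, rfl⟩
  have hSm : MeasurableSet S := by rw [hS_def]; exact hN₀m.compl
  have hScar : S ⊆ D.carrier := fun σ hσ => by
    rw [hS_def] at hσ
    by_contra h
    exact hσ (hsubN h)
  have hSae : ∀ᵐ σ ∂ω, σ ∈ S := by
    rw [ae_iff, hS_def]
    simpa using hN₀
  -- the flow, frozen off `S`
  obtain ⟨φ, hφ_def⟩ : ∃ φ : ℝ → ChainConfig → ChainConfig, ∀ s, φ s = S.piecewise (D.flow s) id :=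
    ⟨_, fun _ => rfl⟩
  have hφm : ∀ s, Measurable (φ s) := fun s => by
    rw [hφ_def s]
    exact Measurable.piecewise hSm (hD.2 s).measurable measurable_id
  have hφS : ∀ s, ∀ σ ∈ S, φ s σ = D.flow s σ := fun s σ hσ => by
    rw [hφ_def s]
    exact Set.piecewise_eq_of_mem _ _ _ hσ
  -- joint measurability of `(s, σ) ↦ W_{m,k}(φ_s σ)`
  have hjoint : ∀ (m : ℤ) (k : ℕ),
      Measurable fun p : ℝ × ChainConfig => P.bmLocalEnergy m k (φ p.1 p.2) := by
    intro m k
    have hcont : ∀ σ, Continuous fun s => P.bmLocalEnergy m k (φ s σ) := by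
      intro σ
      by_cases hσ : σ ∈ S
      · have : (fun s => P.bmLocalEnergy m k (φ s σ)) =
            fun s => P.bmLocalEnergy m k (D.flow s σ) := funext fun s => by rw [hφS s σ hσ]
        rw [this]
        exact continuous_bmLocalEnergy_comp_of_isSolution hUd hVd (D.isSolution σ (hScar hσ)) m k
      · have : (fun s => P.bmLocalEnergy m k (φ s σ)) = fun _ => P.bmLocalEnergy m k σ :=
          funext fun s => by rw [hφ_def s, Set.piecewise_eq_of_notMem _ _ _ hσ]; rfl
        rw [this]
        exact continuous_const
    have h := measurable_uncurry_of_continuous_of_measurable hcont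
      (fun s => (hWm m k).comp (hφm s))
    simpa only [Function.uncurry_def] using h
  -- the dominating functions `Y_{m,k}`
  obtain ⟨G, hG, hG2⟩ : ∃ G : ℤ → ℕ → ℝ × ChainConfig → ℝ≥0∞,
      (∀ m k, G m k = fun p =>
        ENNReal.ofReal (Real.exp (2 * lam * P.bmLocalEnergy m (k + 1) (φ p.1 p.2)))) ∧
      ∀ m k s σ, G m k (s, σ) =
        ENNReal.ofReal (Real.exp (2 * lam * P.bmLocalEnergy m (k + 1) (φ s σ))) :=
    ⟨_, fun _ _ => rfl, fun _ _ _ _ => rfl⟩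
  have hGm : ∀ m k, Measurable (G m k) := fun m k => by
    rw [hG m k]
    exact ((hjoint m (k + 1)).const_mul (2 * lam)).exp.ennreal_ofReal
  obtain ⟨Y, hY⟩ : ∃ Y : ℤ → ℕ → ChainConfig → ℝ≥0∞, ∀ m k σ, Y m k σ =
      ENNReal.ofReal (Real.exp (lam * P.bmLocalEnergy m k σ)) +
        ENNReal.ofReal c * ∫⁻ s in Ioc (0 : ℝ) τ, G m k (s, σ) := ⟨_, fun _ _ _ => rfl⟩
  have hY1m : ∀ m k, Measurable fun σ => ENNReal.ofReal (Real.exp (lam * P.bmLocalEnergy m k σ)) :=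
    fun m k => ((hWm m k).const_mul lam).exp.ennreal_ofReal
  have hY2m : ∀ m k, Measurable fun σ => ∫⁻ s in Ioc (0 : ℝ) τ, G m k (s, σ) := fun m k =>
    (hGm m k).lintegral_prod_left'
  have hYm : ∀ m k, Measurable (Y m k) := fun m k => by
    rw [show Y m k = _ from funext (hY m k)]
    exact (hY1m m k).fun_add ((hY2m m k).const_mul _)
  -- (b) the expectation of `Y_{m,k}`
  have hexpC : ∀ k : ℕ, Real.exp (C * (2 * k + 1)) +
      c * (Real.exp (C * (2 * ((k : ℝ) + 1) + 1)) * τ) ≤ Real.exp (C' * (2 * k + 1)) := by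
    intro k
    have hk0 : (0 : ℝ) ≤ k := Nat.cast_nonneg k
    have h1 : Real.exp (C * (2 * ((k : ℝ) + 1) + 1)) =
        Real.exp (C * (2 * k + 1)) * Real.exp (2 * C) := by
      rw [← Real.exp_add]; ring_nf
    have h2 : 1 + M ≤ Real.exp M := by linarith [Real.add_one_le_exp M]
    have h3 : C * (2 * k + 1) + M ≤ C' * (2 * k + 1) := by rw [hC'_def]; nlinarith
    calc Real.exp (C * (2 * k + 1)) + c * (Real.exp (C * (2 * ((k : ℝ) + 1) + 1)) * τ)
        = Real.exp (C * (2 * k + 1)) * (1 + M) := by rw [h1, hM_def]; ring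
      _ ≤ Real.exp (C * (2 * k + 1)) * Real.exp M := by gcongr
      _ = Real.exp (C * (2 * k + 1) + M) := by rw [Real.exp_add]
      _ ≤ Real.exp (C' * (2 * k + 1)) := Real.exp_le_exp.2 h3
  have hYint : ∀ m k, ∫⁻ σ, Y m k σ ∂ω ≤ ENNReal.ofReal (Real.exp (C' * (2 * k + 1))) := by
    intro m k
    have hI1 : ∫⁻ σ, ENNReal.ofReal (Real.exp (lam * P.bmLocalEnergy m k σ)) ∂ω ≤
        ENNReal.ofReal (Real.exp (C * (2 * k + 1))) := hss lam hlam hlam1 m k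
    have hinner : ∀ s, ∫⁻ σ, G m k (s, σ) ∂ω ≤
        ENNReal.ofReal (Real.exp (C * (2 * ((k : ℝ) + 1) + 1))) := by
      intro s
      have hmeas : Measurable fun σ =>
          ENNReal.ofReal (Real.exp (2 * lam * P.bmLocalEnergy m (k + 1) σ)) :=
        ((hWm m (k + 1)).const_mul (2 * lam)).exp.ennreal_ofReal
      calc ∫⁻ σ, G m k (s, σ) ∂ω
          = ∫⁻ σ, ENNReal.ofReal
              (Real.exp (2 * lam * P.bmLocalEnergy m (k + 1) (D.flow s σ))) ∂ω := by
            refine lintegral_congr_ae ?_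
            filter_upwards [hSae] with σ hσ
            rw [hG2, hφS s σ hσ]
        _ = ∫⁻ σ, ENNReal.ofReal (Real.exp (2 * lam * P.bmLocalEnergy m (k + 1) σ)) ∂ω :=
            (hD.2 s).lintegral_comp hmeas
        _ ≤ _ := by
            have := hss (2 * lam) h2lam hlam2 m (k + 1)
            push_cast at this
            exact this
    have hI2 : ∫⁻ σ, (∫⁻ s in Ioc (0 : ℝ) τ, G m k (s, σ)) ∂ω ≤
        ENNReal.ofReal (Real.exp (C * (2 * ((k : ℝ) + 1) + 1))) * ENNReal.ofReal τ := by
      calc ∫⁻ σ, (∫⁻ s in Ioc (0 : ℝ) τ, G m k (s, σ)) ∂ω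
          = ∫⁻ s in Ioc (0 : ℝ) τ, ∫⁻ σ, G m k (s, σ) ∂ω :=
            (lintegral_prod_symm (G m k) (hGm m k).aemeasurable).symm.trans
              (lintegral_prod (G m k) (hGm m k).aemeasurable)
        _ ≤ ∫⁻ s in Ioc (0 : ℝ) τ, ENNReal.ofReal (Real.exp (C * (2 * ((k : ℝ) + 1) + 1))) :=
            lintegral_mono fun s => hinner s
        _ = ENNReal.ofReal (Real.exp (C * (2 * ((k : ℝ) + 1) + 1))) * ENNReal.ofReal τ := by
            rw [setLIntegral_const, Real.volume_Ioc, sub_zero]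
    calc ∫⁻ σ, Y m k σ ∂ω
        = ∫⁻ σ, ENNReal.ofReal (Real.exp (lam * P.bmLocalEnergy m k σ)) ∂ω +
            ENNReal.ofReal c * ∫⁻ σ, (∫⁻ s in Ioc (0 : ℝ) τ, G m k (s, σ)) ∂ω := by
          simp only [hY]
          rw [lintegral_add_left (hY1m m k), lintegral_const_mul _ (hY2m m k)]
      _ ≤ ENNReal.ofReal (Real.exp (C * (2 * k + 1))) + ENNReal.ofReal c *
            (ENNReal.ofReal (Real.exp (C * (2 * ((k : ℝ) + 1) + 1))) * ENNReal.ofReal τ) := by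
          gcongr
      _ = ENNReal.ofReal (Real.exp (C * (2 * k + 1)) +
            c * (Real.exp (C * (2 * ((k : ℝ) + 1) + 1)) * τ)) := by
          rw [ENNReal.ofReal_add (by positivity) (by positivity), ENNReal.ofReal_mul hc0,
            ENNReal.ofReal_mul (by positivity)]
      _ ≤ ENNReal.ofReal (Real.exp (C' * (2 * k + 1))) := ENNReal.ofReal_le_ofReal (hexpC k)
  -- (c) domination along the orbits from `S`
  have hdom : ∀ (m : ℤ) (k : ℕ), ∀ σ ∈ S, ∀ t ∈ Icc (0 : ℝ) τ,
      ENNReal.ofReal (Real.exp (lam * P.bmLocalEnergy m k (D.flow t σ))) ≤ Y m k σ := by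
    intro m k σ hσ t ht
    have hsol := D.isSolution σ (hScar hσ)
    have h := hpath (fun s => D.flow s σ) hsol m k lam τ hlam hτ t ht
    simp only [D.flow_zero σ (hScar hσ)] at h
    rw [← hc_def] at h
    have hg_cont : Continuous fun s =>
        Real.exp (2 * lam * P.bmLocalEnergy m (k + 1) (D.flow s σ)) :=
      Real.continuous_exp.comp
        (continuous_const.mul (continuous_bmLocalEnergy_comp_of_isSolution hUd hVd hsol m (k + 1)))
    have hint_eq : ENNReal.ofReal
        (∫ s in (0 : ℝ)..τ, Real.exp (2 * lam * P.bmLocalEnergy m (k + 1) (D.flow s σ))) =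
          ∫⁻ s in Ioc (0 : ℝ) τ, G m k (s, σ) := by
      rw [intervalIntegral.integral_of_le hτ, ofReal_integral_eq_lintegral_ofReal
        hg_cont.integrableOn_Ioc (ae_of_all _ fun s => (Real.exp_pos _).le)]
      refine lintegral_congr fun s => ?_
      rw [hG2, hφS s σ hσ]
    calc ENNReal.ofReal (Real.exp (lam * P.bmLocalEnergy m k (D.flow t σ)))
        ≤ ENNReal.ofReal (Real.exp (lam * P.bmLocalEnergy m k σ) +
            c * ∫ s in (0 : ℝ)..τ, Real.exp (2 * lam * P.bmLocalEnergy m (k + 1) (D.flow s σ))) :=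
          ENNReal.ofReal_le_ofReal h
      _ = ENNReal.ofReal (Real.exp (lam * P.bmLocalEnergy m k σ)) +
            ENNReal.ofReal c * ∫⁻ s in Ioc (0 : ℝ) τ, G m k (s, σ) := by
          rw [ENNReal.ofReal_add (Real.exp_pos _).le (mul_nonneg hc0
            (intervalIntegral.integral_nonneg hτ fun s _ => (Real.exp_pos _).le)),
            ENNReal.ofReal_mul hc0, hint_eq]
      _ = Y m k σ := (hY m k σ).symm
  -- (d) exponential Chebyshev inequality for the sup over `[0, τ]`, box by box
  obtain ⟨A, hA⟩ : ∃ A : ℕ → ℤ → ℕ → Set ChainConfig, ∀ Nn m k, A Nn m k =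
      {σ | Real.log (Real.exp 1 + |(m : ℝ)|) < k ∧ σ ∈ S ∧
        ∃ t ∈ Icc (0 : ℝ) τ, (Nn : ℝ) < P.bmLocalEnergy m k (D.flow t σ) / (2 * (k : ℝ) + 1)} :=
    ⟨_, fun _ _ _ => rfl⟩
  have hcheb : ∀ (Nn : ℕ) (m : ℤ) (k : ℕ),
      ω (A Nn m k) ≤ ENNReal.ofReal (Real.exp (-(lam * Nn - C') * (2 * (k : ℝ) + 1))) := by
    intro Nn m k
    have hT : (0 : ℝ) < 2 * (k : ℝ) + 1 := by positivity
    obtain ⟨e, he⟩ : ∃ e : ℝ≥0∞,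
        e = ENNReal.ofReal (Real.exp (-(lam * Nn * (2 * (k : ℝ) + 1)))) := ⟨_, rfl⟩
    calc ω (A Nn m k) ≤ ∫⁻ σ, e * Y m k σ ∂ω := by
          refine meas_le_lintegral₀ ((hYm m k).const_mul e).aemeasurable fun σ hσ => ?_
          simp only [hA, Set.mem_setOf_eq] at hσ
          obtain ⟨-, hσS, t, ht, hlt⟩ := hσ
          have hlt' : (Nn : ℝ) * (2 * (k : ℝ) + 1) < P.bmLocalEnergy m k (D.flow t σ) :=
            (lt_div_iff₀ hT).1 hlt
          calc (1 : ℝ≥0∞) ≤ ENNReal.ofReal (Real.exp (-(lam * Nn * (2 * (k : ℝ) + 1))) *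
                Real.exp (lam * P.bmLocalEnergy m k (D.flow t σ))) := by
                refine ENNReal.one_le_ofReal.2 ?_
                rw [← Real.exp_add]
                exact Real.one_le_exp (by nlinarith)
            _ = e * ENNReal.ofReal (Real.exp (lam * P.bmLocalEnergy m k (D.flow t σ))) := by
                rw [he, ENNReal.ofReal_mul (Real.exp_pos _).le]
            _ ≤ e * Y m k σ := by
                gcongr
                exact hdom m k σ hσS t ht
      _ = e * ∫⁻ σ, Y m k σ ∂ω := lintegral_const_mul e (hYm m k)
      _ ≤ e * ENNReal.ofReal (Real.exp (C' * (2 * k + 1))) := by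
          gcongr
          exact hYint m k
      _ = ENNReal.ofReal (Real.exp (-(lam * Nn - C') * (2 * (k : ℝ) + 1))) := by
          rw [he, ← ENNReal.ofReal_mul (Real.exp_pos _).le, ← Real.exp_add]
          ring_nf
  -- (e) union bound, and `N → ∞`
  have hUb : ∀ Nn : ℕ, 3 / 2 ≤ lam * Nn - C' →
      ω (⋃ m : ℤ, ⋃ k : ℕ, A Nn m k) ≤ ENNReal.ofReal (Real.exp (-(lam * Nn - C'))) * Kc := by
    intro Nn hNn
    refine hunion ω (lam * Nn - C') hNn (A Nn) (fun m k _ => hcheb Nn m k) (fun m k hk => ?_)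
    rw [hA]
    ext σ
    simp [hk]
  have hBsub : ∀ Nn : ℕ, {σ | σ ∈ S ∧ ∃ t ∈ Icc (0 : ℝ) τ, D.flow t σ ∉ P.bmGood} ⊆
      ⋃ m : ℤ, ⋃ k : ℕ, A Nn m k := by
    intro Nn σ hσ
    obtain ⟨hσS, t, ht, hbad⟩ := hσ
    simp only [bmGood, Set.mem_setOf_eq, not_bddAbove_iff] at hbad
    obtain ⟨r, ⟨m, k, hk, rfl⟩, hr⟩ := hbad Nn
    refine Set.mem_iUnion.2 ⟨m, Set.mem_iUnion.2 ⟨k, ?_⟩⟩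
    rw [hA]
    exact ⟨hk, hσS, t, ht, hr⟩
  have hev : ∀ᶠ Nn : ℕ in atTop, 3 / 2 ≤ lam * Nn - C' := by
    filter_upwards [tendsto_natCast_atTop_atTop.eventually_ge_atTop ((C' + 3 / 2) / lam)]
      with Nn hNn
    rw [div_le_iff₀ hlam] at hNn
    linarith
  have hdecayR : Tendsto (fun Nn : ℕ => Real.exp (-(lam * Nn - C'))) atTop (𝓝 0) := by
    have h := (tendsto_pow_atTop_nhds_zero_of_lt_one (Real.exp_nonneg (-lam))
      (Real.exp_lt_one_iff.2 (neg_lt_zero.2 hlam))).const_mul (Real.exp C')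
    rw [mul_zero] at h
    refine h.congr fun Nn => ?_
    rw [← Real.exp_nat_mul, ← Real.exp_add]
    ring_nf
  have hdecay : Tendsto (fun Nn : ℕ => ENNReal.ofReal (Real.exp (-(lam * Nn - C'))) * Kc) atTop
      (𝓝 0) := by
    have h := ENNReal.Tendsto.mul_const (ENNReal.tendsto_ofReal hdecayR) (Or.inr hKc)
    simpa using h
  have hB0 : ω {σ | σ ∈ S ∧ ∃ t ∈ Icc (0 : ℝ) τ, D.flow t σ ∉ P.bmGood} = 0 := by
    refine le_antisymm (ge_of_tendsto hdecay ?_) (zero_le)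
    filter_upwards [hev] with Nn hNn
    exact (measure_mono (hBsub Nn)).trans (hUb Nn hNn)
  -- conclusion
  filter_upwards [hSae, measure_eq_zero_iff_ae_notMem.1 hB0] with σ hσS hσB t ht
  by_contra hbad
  exact hσB ⟨hσS, t, ht, hbad⟩

/-! ### §3 All times -/

/-- **Superstable invariant states are carried by all-time-good orbits** (sup-in-time form of
Buttà–Marchioro 2016, eq. (2.6), `d = 1`). Let `U`, `V` be even non-negative polynomials (in the
sense of `IsEvenPolyOfDegree`, `deg V = 2s₂ ≥ 2`), `ω` a state with the superstability estimate (2.3), and `D` any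
infinite-volume dynamics of the chain preserving `ω`. Then `ω`-a.e. orbit of `D` lies in BM's good
set `𝒳₀ = {Q < ∞}` at every time: `∀ᵐ σ ∂ω, ∀ t, D.flow t σ ∈ 𝒳₀` (forward times from
`ae_forall_mem_Icc_flow_mem_bmGood` and `τ ∈ ℕ`; negative times by the group law `flow_add` and the
invariance of `ω` under `flow (-n)`). [folklore] -/
theorem ae_forall_flow_mem_bmGood (P : OscillatorChain) {s₁ s₂ : ℕ} (h₂ : 1 ≤ s₂)
    (hU : IsEvenPolyOfDegree P.U s₁) (hV : IsEvenPolyOfDegree P.V s₂) {ω : Measure ChainConfig}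
    (hω : P.HasSuperstabilityEstimate ω) (D : InfiniteChainDynamics P)
    (hD : D.PreservesMeasure ω) :
    ∀ᵐ σ ∂ω, ∀ t : ℝ, D.flow t σ ∈ P.bmGood := by
  have hfwd : ∀ᵐ σ ∂ω, ∀ n : ℕ, ∀ t ∈ Icc (0 : ℝ) n, D.flow t σ ∈ P.bmGood :=
    ae_all_iff.2 fun n =>
      P.ae_forall_mem_Icc_flow_mem_bmGood h₂ hU hV hω D hD (Nat.cast_nonneg n)
  have hback : ∀ᵐ σ ∂ω, ∀ n : ℕ, ∀ n' : ℕ, ∀ t ∈ Icc (0 : ℝ) n',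
      D.flow t (D.flow (-(n : ℝ)) σ) ∈ P.bmGood :=
    ae_all_iff.2 fun n => (hD.2 (-(n : ℝ))).quasiMeasurePreserving.tendsto_ae.eventually hfwd
  filter_upwards [hD.1, hfwd, hback] with σ hσ hf hb t
  rcases le_or_gt 0 t with ht | ht
  · exact hf ⌈t⌉₊ t ⟨ht, Nat.le_ceil t⟩
  · have hn : -t ≤ (⌈-t⌉₊ : ℕ) := Nat.le_ceil (-t)
    have h := hb ⌈-t⌉₊ ⌈-t⌉₊ (t + ⌈-t⌉₊) ⟨by linarith, by linarith⟩
    rwa [← D.flow_add hσ, show t + (⌈-t⌉₊ : ℝ) + -((⌈-t⌉₊ : ℕ) : ℝ) = t by ring] at h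

/-- The instance for the tree's pinned anharmonic chain `U = ω₂q²/2 + lam q⁴/4`,
`V = r²/2 + β r⁴/4` (`ω₂ ≥ 0`, `lam, β > 0`; `σ₁ = σ₂ = 2`): every dynamics preserving a
superstable state is carried by all-time-good orbits. [folklore] -/
theorem ae_forall_flow_mem_bmGood_pinnedChain {ω₂ lam β : ℝ} (γ : ℝ) (hω₂ : 0 ≤ ω₂)
    (hl : 0 < lam) (hβ : 0 < β) {ω : Measure ChainConfig}
    (hω : (pinnedChain ω₂ lam β γ).HasSuperstabilityEstimate ω)
    (D : InfiniteChainDynamics (pinnedChain ω₂ lam β γ)) (hD : D.PreservesMeasure ω) :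
    ∀ᵐ σ ∂ω, ∀ t : ℝ, D.flow t σ ∈ (pinnedChain ω₂ lam β γ).bmGood :=
  (pinnedChain ω₂ lam β γ).ae_forall_flow_mem_bmGood (s₁ := 2) (s₂ := 2) (by norm_num)
    (pinnedChain_isEvenPolyOfDegree_U β γ hω₂ hl) (pinnedChain_isEvenPolyOfDegree_V ω₂ lam γ hβ) hω D hD

end OscillatorChain

end Literature.MathematicalPhysics.KineticTheory.HeatConduction
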